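import Literature.AlgebraicGeometry.ModuliOfAbelianVarieties.SiegelFineModuliSchemeOfFrameSlices
import Literature.AlgebraicGeometry.ModuliOfAbelianVarieties.SiegelModuliFrameSliceRepresents
import Literature.AlgebraicGeometry.ModuliOfAbelianVarieties.SiegelLinearRigidificationProjective
import Literature.AlgebraicGeometry.AbelianSchemes.AbelianSchemeDualTransportOfBaseChange
import Literature.AlgebraicGeometry.Morphisms.ProjectiveSpaceOverBasePoints
import HarnessLib

/-!
# THE FINE MODULI SCHEME FROM THE LINEARLY RIGIDIFIED COVARIANT — F-8 assembled
# ([MumfordFogartyKirwan1994] Prop. 7.6 / Thm. 7.9: `A⁰ = ⋃_R V_R` represents Mumford's functor)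

Layer `Literature/AlgebraicGeometry/ModuliOfAbelianVarieties`; THEOREMS ONLY (no definition, no named fact, no instance, no notation,
no `sorry`).  Cell `hodgecm-mathlib` (D-0151), F-8 (8ε) FILE 2B, second half = the covariant instantiation (B-p08 (g13); sequencer
B-plan1 (g16) 08:46:52Z «(8ε) assembly `siegelFineModuliSchemeOfCovariant 𝓗 hN D₀ hcov : SiegelFineModuliScheme g N δ`», theorem-only
per 08:50:54Z).  HC_CM is proved only modulo the 7 printed citations until rung 0 closes; nothing here is about HC.

INPUT: a linearly rigidified covariant `𝓗 : SiegelFramedCovariant g N δ J` (★ (8α), the F-6 output type) with `#J + 1 = 6^g · d`,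
`N ≥ 3`, `δ` a type, with the unit hypothesis of its Poincaré sheaf (`unitH`) (its universal family IS projective over `H`: ★ (F4)
`IsLinearRigidification.isProjective`, B-p11 (g18));
the covering hypothesis `hcov` ([MumfordFogartyKirwan1994] Prop. 7.7, over algebraically closed fields of characteristic `0`: every
triple is `R`-framed for some `(m+2)`-tuple `R` of exponent vectors — the F-9a count); and the F-3 letter of record `hdual`
(«[MumfordFogartyKirwan1994] Cor. 6.8 Zariski-locally on the base»).  OUTPUT **`SiegelFramedCovariant.exists_siegelFineModuliScheme`**: a
fine moduli scheme `𝓜 : SiegelFineModuliScheme g N δ` (★ carrier) COVERED by open immersions of the standard-frame SLICES `V_R ⊂ H` of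
★ (8γ) `SiegelModuliFrameSliceRepresents` (over ℚ, jointly surjective, overlapping along the frame opens) along which `𝓜.univ`
restricts to `𝓗.univ|_{V_R}` — [MumfordFogartyKirwan1994] p. 138 «`ℳ` is represented by the union `A` of the quotients `V_R`».
Road: ★ FILE 2B first half `exists_siegelFineModuliScheme_of_frameSlices` at `tup := id`, `V R := V_R`, `ZV R := 𝓗.univ|_{V_R}`,
`hrep := ★ sliceRepresents_slice`, `huniv := ★ isFrameOn_univ_baseChange_slice`, `hprojV` from ★ (F4) by §0 (projective morphisms
are stable under base change, ★ `isPullback_projectiveSpaceMap`), `unitV` from `unitH` (★ `DualPair.nonempty_unitHatSlice_baseChange_iso`).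

## References
* [MumfordFogartyKirwan1994] D. Mumford, J. Fogarty, F. Kirwan, *Geometric Invariant Theory*, 3rd ed. (1994), Ch. 3 §1 Def. 3.3 and
  Prop. 3.1 (p. 68), Ch. 6 §1 Cor. 6.8 (p. 118), Ch. 7 §2 Def. 7.5 (p. 130), Prop. 7.6 (p. 136; proof pp. 136–138), Prop. 7.7 (p. 138),
  §3 Thm. 7.9 and the remark after it (p. 139).
* [Deligne1971TravauxShimura] P. Deligne, *Travaux de Shimura*, Sém. Bourbaki 389 (1971), 4.16 (p. 150).
* [Hartshorne1977] R. Hartshorne, *Algebraic Geometry* (1977), II §4 Definition p. 103 (projective morphism), II Ex. 3.11 (a).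
-/

noncomputable section

-- the `Over`-category structure maps of ★ `baseChange` are not reducible (as in ★ `SiegelModuliOfOpenCharts`).
set_option backward.isDefEq.respectTransparency false

open CategoryTheory CategoryTheory.Limits AlgebraicGeometry TopologicalSpace
open Literature.AlgebraicGeometry.AbelianSchemes Literature.AlgebraicGeometry.Motives
open Literature.AlgebraicGeometry.Morphisms (IsProjective projectiveSpace projectiveSpaceFst projectiveSpaceMap
  isPullback_projectiveSpaceMap intU projectiveSpaceInt isPullback_projToSpec_projMap_terminal)
open Literature.AlgebraicGeometry.Morphisms.ProjFrame (frameDetSection slice sliceι)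
open Literature.AlgebraicGeometry.ProjectiveSpace.ProjFrame (stdChart)
open Literature.AlgebraicGeometry.GroupSchemes.GeneralLinearGroupScheme (intCast actCore)

namespace Literature.AlgebraicGeometry.ModuliOfAbelianVarieties

open PolarizedAbelianSchemeWithLevel AbelianSchemeOver

/-! ## §0 Projective morphisms are stable under base change -/

/-- **A base change of a projective morphism is projective** ([Hartshorne1977] II Ex. 3.11 (a) for closed immersions + `𝐏(ι; Y') =
Y' ×_Y 𝐏(ι; Y)`, ★ `isPullback_projectiveSpaceMap`): if `f : X → Y` factors as a closed immersion into `𝐏(ι; Y)` followed by the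
projection, then `X ×_Y Y' → Y'` factors through the closed immersion `X ×_Y Y' ↪ 𝐏(ι; Y')` (Mathlib: closed immersions are stable
under base change). [cite: Hartshorne1977, II §4 Definition p.103 (projective morphism)] [cite: GortzWedhorn2020, Section (4.12)] -/
theorem isProjective_pullback_snd {X Y Y' : Scheme.{0}} {f : X ⟶ Y} (hf : IsProjective f) (u : Y' ⟶ Y) :
    IsProjective (pullback.snd f u) := by
  obtain ⟨ι, hι, j, hj, hjf⟩ := hf
  haveI := hj
  have w : (pullback.fst f u ≫ j) ≫ projectiveSpaceFst ι Y = pullback.snd f u ≫ u := by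
    rw [Category.assoc, hjf, pullback.condition]
  let j' : pullback f u ⟶ projectiveSpace ι Y' := (isPullback_projectiveSpaceMap ι u).lift (pullback.fst f u ≫ j) (pullback.snd f u) w
  have hj'₁ : j' ≫ projectiveSpaceMap ι u = pullback.fst f u ≫ j := (isPullback_projectiveSpaceMap ι u).lift_fst _ _ w
  have hj'₂ : j' ≫ projectiveSpaceFst ι Y' = pullback.snd f u := (isPullback_projectiveSpaceMap ι u).lift_snd _ _ w
  -- the square `X' → 𝐏(ι; Y')` over `X → 𝐏(ι; Y)` is cartesian (paste the base-change rectangle along `𝐏(ι; Y') = Y' ×_Y 𝐏(ι; Y)`)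
  have hsq : IsPullback j' (pullback.fst f u) (projectiveSpaceMap ι u) j := by
    refine IsPullback.of_right (h₁₂ := projectiveSpaceFst ι Y') (v₁₃ := u) (h₂₂ := projectiveSpaceFst ι Y) ?_ hj'₁
      (isPullback_projectiveSpaceMap ι u).flip
    rw [hj'₂, hjf]
    exact (IsPullback.of_hasPullback f u).flip
  haveI : IsClosedImmersion j' := MorphismProperty.of_isPullback (P := @IsClosedImmersion) hsq.flip hj
  exact ⟨ι, hι, j', inferInstance, hj'₂⟩

/-! ## §1 The fine moduli scheme of the covariant -/

namespace SiegelFramedCovariant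

variable {g N : ℕ} {δ : Fin g → ℕ} {J : Type} (𝓗 : SiegelFramedCovariant g N δ J)

/-- **[MumfordFogartyKirwan1994] Prop. 7.6 / Thm. 7.9 — THE FINE MODULI SCHEME `A⁰ = ⋃_R V_R` OF THE LINEARLY RIGIDIFIED COVARIANT.**
For a covariant `𝓗` (★ (8α)) with `#J + 1 = 6^g · d`, `N ≥ 3`, `δ` a type, the unit hypothesis `unitH` of its Poincaré sheaf, the
frame-count hypothesis `hcov` (every triple over an algebraically closed field of characteristic `0` is
`R`-framed for some `R` — [MumfordFogartyKirwan1994] Prop. 7.7, F-9a) and the F-3 letter `hdual`: THERE IS a fine moduli scheme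
`𝓜 : SiegelFineModuliScheme g N δ` covered by open immersions `j R : V_R ↪ 𝓜.M` of the STANDARD-FRAME SLICES `V_R ⊂ H` (★ (8γ)), over
ℚ via `V_R ↪ H → Spec ℚ`, jointly surjective and overlapping along the frame opens `U_R`, along which `𝓜.univ` restricts to `𝓗.univ|_{V_R}`.
★ `exists_siegelFineModuliScheme_of_frameSlices` ⊕ ★ `sliceRepresents_slice` ⊕ ★ `isFrameOn_univ_baseChange_slice` ⊕ ★ (F4)
`IsLinearRigidification.isProjective` ⊕ §0 ⊕ ★ `nonempty_unitHatSlice_baseChange_iso`.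
[cite: MumfordFogartyKirwan1994, Ch. 7 §2 Proposition 7.6 (p. 136; proof pp. 136–138)]
[cite: MumfordFogartyKirwan1994, Ch. 7 §3 Theorem 7.9 and the remark after it (p. 139)]
[cite: MumfordFogartyKirwan1994, Ch. 3 §1 Proposition 3.1 and Definition 3.3 (p. 68)] [cite: Deligne1971TravauxShimura, 4.16 p. 150] -/
theorem exists_siegelFineModuliScheme [Finite J] (hJ : Nat.card J + 1 = 6 ^ g * polarizationDegree δ) (hN : 3 ≤ N)
    (hδ : IsPolarizationType δ)
    (unitH : Nonempty ((Scheme.Modules.pullback (DualPair.unitHatSlice 𝓗.univ.D)).obj 𝓗.univ.D.P ≅ SheafOfModules.unit _))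
    (hcov : ∀ ⦃Ω : Type⦄ [Field Ω] [IsAlgClosed Ω] (_ : Spec (.of Ω) ⟶ Spec (.of ℚ))
      (Q : PolarizedAbelianSchemeWithLevel g N δ (Spec (.of Ω))), ∃ R : Fin (Nat.card J + 2) → (Fin g ⊕ Fin g → ZMod N),
        IsFrameOn J Q R)
    (hdual : ∀ ⦃S : Scheme.{0}⦄ [IsLocallyNoetherian S] (_fS : S ⟶ Spec (.of ℚ)) (A : AbelianSchemeOver S),
      (∀ s : S, ∃ (U : Scheme.{0}) (i : U ⟶ S) (_ : IsOpenImmersion i) (_ : s ∈ Set.range i.base)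
        (B : AbelianSchemeOver U) (G : B.X.left ⟶ A.X.left), B.IsBaseChangeVia A i G ∧ IsProjective B.X.hom) →
      Nonempty A.DualPair) :
    ∃ (𝓜 : SiegelFineModuliScheme g N δ)
      (j : ∀ R : Fin (Nat.card J + 2) → (Fin g ⊕ Fin g → ZMod N),
        slice (fun k => (𝓗.H.left.basicOpen (frameDetSection (markedTuple J 𝓗.univ 𝓗.emb R) (stdChart (Nat.card J)))).ι ≫
          markedTuple J 𝓗.univ 𝓗.emb R k) (stdChart (Nat.card J)) (𝓗.preU_ι_markedTuple_stdChart_eq_top R) ⟶ 𝓜.M.left)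
      (_ : ∀ R, IsOpenImmersion (j R))
      (_ : ∀ R, j R ≫ 𝓜.M.hom = (sliceι _ _ (𝓗.preU_ι_markedTuple_stdChart_eq_top R) ≫
        (𝓗.H.left.basicOpen (frameDetSection (markedTuple J 𝓗.univ 𝓗.emb R) (stdChart (Nat.card J)))).ι) ≫ 𝓗.H.hom)
      (Gc : ∀ R, (𝓗.univ.baseChange (sliceι _ _ (𝓗.preU_ι_markedTuple_stdChart_eq_top R) ≫
        (𝓗.H.left.basicOpen (frameDetSection (markedTuple J 𝓗.univ 𝓗.emb R) (stdChart (Nat.card J)))).ι)).A.X.left ⟶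
          𝓜.univ.A.X.left)
      (Ĝc : ∀ R, (𝓗.univ.baseChange (sliceι _ _ (𝓗.preU_ι_markedTuple_stdChart_eq_top R) ≫
        (𝓗.H.left.basicOpen (frameDetSection (markedTuple J 𝓗.univ 𝓗.emb R) (stdChart (Nat.card J)))).ι)).D.hat.X.left ⟶
          𝓜.univ.D.hat.X.left),
      (∀ R, (𝓗.univ.baseChange (sliceι _ _ (𝓗.preU_ι_markedTuple_stdChart_eq_top R) ≫
          (𝓗.H.left.basicOpen (frameDetSection (markedTuple J 𝓗.univ 𝓗.emb R) (stdChart (Nat.card J)))).ι)).IsBaseChangeVia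
            𝓜.univ (j R) (Gc R) (Ĝc R)) ∧
      (∀ R R', (j R') ⁻¹ᵁ (j R).opensRange =
          frameOpen J (𝓗.univ.baseChange (sliceι _ _ (𝓗.preU_ι_markedTuple_stdChart_eq_top R') ≫
            (𝓗.H.left.basicOpen (frameDetSection (markedTuple J 𝓗.univ 𝓗.emb R') (stdChart (Nat.card J)))).ι)) R) ∧
      (⨆ R, (j R).opensRange = ⊤) := by
  haveI := 𝓗.isLocallyNoetherian
  haveI := fun R : Fin (Nat.card J + 2) → (Fin g ⊕ Fin g → ZMod N) => 𝓗.isLocallyNoetherian_slice R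
  exact exists_siegelFineModuliScheme_of_frameSlices J hJ hN hδ id hcov _ (fun R => (sliceι _ _ (𝓗.preU_ι_markedTuple_stdChart_eq_top R) ≫
      (𝓗.H.left.basicOpen (frameDetSection (markedTuple J 𝓗.univ 𝓗.emb R) (stdChart (Nat.card J)))).ι) ≫ 𝓗.H.hom) _
    (fun R => 𝓗.isFrameOn_univ_baseChange_slice R)
    (fun R _ _ fT P' hP' => 𝓗.sliceRepresents_slice R hN fT P' hP')
    (fun R => isProjective_pullback_snd
      (IsLinearRigidification.isProjective J 𝓗.H.hom 𝓗.isLinearRigidification_emb) _)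
    hdual (fun R => 𝓗.univ.D.nonempty_unitHatSlice_baseChange_iso unitH)

end SiegelFramedCovariant

end Literature.AlgebraicGeometry.ModuliOfAbelianVarieties

end
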